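import Summits.AtomisticToContinuum.Crystallization.Theorems.ChartedPlanarOrderSepCounting

/-!
# ChartedPlanarOrder — planar geometry relative to a unit normal (`LayerFrame`)

decomp-a2c lens-3 (generation 23/24; N = `Theses.ChartedPlanarOrder.ChartedZeroExcessLayered`, PS column).
Third building block for the stacked-layer dichotomy (α) `StackedDichotomy`: frame-free estimates in `E3`
relative to a UNIT NORMAL `ν` of the period plane `span {a, b}` of a stacked layered profile.  All statements
are elementary Euclidean geometry; the proofs go through an orthonormal frame `e` with `e 0 = ν`
(`ChartedPlanarOrderSepCounting.exists_onb`).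

* §1 frame coordinates: `inner_eq_sum_frame`, `norm_sq_planar`, `inner_planar`.
* §2 ★ `planar_pinning` — for `a b r ⊥ ν`:
  `‖r‖² · (‖a‖²‖b‖² − ⟪a,b⟫²) ≤ (|⟪r,a⟫|‖b‖ + |⟪r,b⟫|‖a‖)²`
  (2D Cramer: a planar vector nearly orthogonal to two independent planar vectors is short).
* §3 ★ `tilt_bound` — a unit vector `n'` with `|⟪n',a⟫|, |⟪n',b⟫| ≤ ε` is nearly `±ν`:
  `(1 − ⟪ν,n'⟫²) · (‖a‖²‖b‖² − ⟪a,b⟫²) ≤ (ε (‖a‖ + ‖b‖))²`.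
* §4 ★ `height_transfer` — heights along `ν` versus heights along a nearby unit vector `n'`:
  `(⟪ν,z⟫ − ⟪n',z⟫⟪ν,n'⟫)² ≤ (1 − ⟪ν,n'⟫²) (‖z‖² − ⟪n',z⟫²)`.
* §5 ★ `exists_lattice_reduction` — for `a b ⊥ ν` independent and `t ⊥ ν` there are `i j : ℤ` with
  `‖t − (i • a + j • b)‖ ≤ (‖a‖ + ‖b‖) / 2` (crude covering radius of the planar lattice).
* §6 `norm_sq_add_smul_normal` — Pythagoras `‖t + h • ν‖² = ‖t‖² + h²` for `t ⊥ ν`.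
-/

open scoped RealInnerProductSpace
open Summit.AtomisticToContinuum.Crystallization.Theorems.ChartedPlanarOrderRigidityDoor (E3)
open Summit.AtomisticToContinuum.Crystallization.Theorems.ChartedPlanarOrderSepCounting (exists_onb norm_sq_eq_sum_inner)

namespace Summit.AtomisticToContinuum.Crystallization.Theorems.ChartedPlanarOrderLayerFrame

/-! ## §1 Frame coordinates -/

/-- `⟪x, y⟫` is the sum of products of the three frame coordinates. -/
theorem inner_eq_sum_frame (e : OrthonormalBasis (Fin 3) ℝ E3) (x y : E3) :
    ⟪x, y⟫ = ⟪e 0, x⟫ * ⟪e 0, y⟫ + ⟪e 1, x⟫ * ⟪e 1, y⟫ + ⟪e 2, x⟫ * ⟪e 2, y⟫ := by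
  rw [← e.sum_inner_mul_inner x y, Fin.sum_univ_three, real_inner_comm (e 0) x, real_inner_comm (e 1) x,
    real_inner_comm (e 2) x]

/-- squared norm of a vector orthogonal to `e 0`. -/
theorem norm_sq_planar (e : OrthonormalBasis (Fin 3) ℝ E3) {x : E3} (hx : ⟪e 0, x⟫ = 0) :
    ‖x‖ ^ 2 = ⟪e 1, x⟫ ^ 2 + ⟪e 2, x⟫ ^ 2 := by
  rw [norm_sq_eq_sum_inner e, hx]; ring

/-- inner product of two vectors orthogonal to `e 0`. -/
theorem inner_planar (e : OrthonormalBasis (Fin 3) ℝ E3) {x y : E3} (hx : ⟪e 0, x⟫ = 0) :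
    ⟪x, y⟫ = ⟪e 1, x⟫ * ⟪e 1, y⟫ + ⟪e 2, x⟫ * ⟪e 2, y⟫ := by
  rw [inner_eq_sum_frame e, hx]; ring

/-- a vector is determined by its frame coordinates: if all three vanish, the vector is zero. -/
theorem eq_zero_of_frame (e : OrthonormalBasis (Fin 3) ℝ E3) {x : E3} (h0 : ⟪e 0, x⟫ = 0) (h1 : ⟪e 1, x⟫ = 0)
    (h2 : ⟪e 2, x⟫ = 0) : x = 0 := by
  have h := norm_sq_eq_sum_inner e x
  rw [h0, h1, h2] at h
  have : ‖x‖ = 0 := by nlinarith [norm_nonneg x]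
  exact norm_eq_zero.mp this

/-! ## §2 Planar pinning (2D Cramer) -/

/-- the 2D Gram identity in frame coordinates: for `a b ⊥ e 0`,
`(a₁ b₂ − a₂ b₁)² = ‖a‖² ‖b‖² − ⟪a,b⟫²`. -/
theorem det_sq_eq_gram (e : OrthonormalBasis (Fin 3) ℝ E3) {a b : E3} (ha : ⟪e 0, a⟫ = 0) (hb : ⟪e 0, b⟫ = 0) :
    (⟪e 1, a⟫ * ⟪e 2, b⟫ - ⟪e 2, a⟫ * ⟪e 1, b⟫) ^ 2 = ‖a‖ ^ 2 * ‖b‖ ^ 2 - ⟪a, b⟫ ^ 2 := by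
  rw [norm_sq_planar e ha, norm_sq_planar e hb, inner_planar e ha]; ring

/-- ★ PLANAR PINNING.  For a unit normal `ν` and `a b r ⊥ ν`:
`‖r‖² (‖a‖²‖b‖² − ⟪a,b⟫²) ≤ (|⟪r,a⟫| ‖b‖ + |⟪r,b⟫| ‖a‖)²`.  (Cramer's rule in the plane `ν^⊥`:
`det · r = ⟪r,a⟫ · b^⟂' − ⟪r,b⟫ · a^⟂'` with `‖a^⟂'‖ = ‖a‖`, `‖b^⟂'‖ = ‖b‖`.) -/
theorem planar_pinning {ν a b r : E3} (hν : ‖ν‖ = 1) (ha : ⟪ν, a⟫ = 0) (hb : ⟪ν, b⟫ = 0) (hr : ⟪ν, r⟫ = 0) :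
    ‖r‖ ^ 2 * (‖a‖ ^ 2 * ‖b‖ ^ 2 - ⟪a, b⟫ ^ 2) ≤ (|⟪r, a⟫| * ‖b‖ + |⟪r, b⟫| * ‖a‖) ^ 2 := by
  obtain ⟨e, he⟩ := exists_onb hν
  rw [← he] at ha hb hr
  have hra : ⟪r, a⟫ = ⟪e 1, r⟫ * ⟪e 1, a⟫ + ⟪e 2, r⟫ * ⟪e 2, a⟫ := inner_planar e hr
  have hrb : ⟪r, b⟫ = ⟪e 1, r⟫ * ⟪e 1, b⟫ + ⟪e 2, r⟫ * ⟪e 2, b⟫ := inner_planar e hr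
  have hab : ⟪a, b⟫ = ⟪e 1, a⟫ * ⟪e 1, b⟫ + ⟪e 2, a⟫ * ⟪e 2, b⟫ := inner_planar e ha
  have hrr : ‖r‖ ^ 2 = ⟪e 1, r⟫ ^ 2 + ⟪e 2, r⟫ ^ 2 := norm_sq_planar e hr
  have haa : ‖a‖ ^ 2 = ⟪e 1, a⟫ ^ 2 + ⟪e 2, a⟫ ^ 2 := norm_sq_planar e ha
  have hbb : ‖b‖ ^ 2 = ⟪e 1, b⟫ ^ 2 + ⟪e 2, b⟫ ^ 2 := norm_sq_planar e hb
  -- Lagrange identity in the plane: det² ‖r‖² = ‖⟪r,a⟫ b − ⟪r,b⟫ a‖²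
  have hkey : ‖r‖ ^ 2 * (‖a‖ ^ 2 * ‖b‖ ^ 2 - ⟪a, b⟫ ^ 2) =
      ⟪r, a⟫ ^ 2 * ‖b‖ ^ 2 + ⟪r, b⟫ ^ 2 * ‖a‖ ^ 2 - 2 * (⟪r, a⟫ * ⟪r, b⟫) * ⟪a, b⟫ := by
    rw [hrr, haa, hbb, hra, hrb, hab]; ring
  have hcs : |⟪a, b⟫| ≤ ‖a‖ * ‖b‖ := abs_real_inner_le_norm a b
  have h1 : -(2 * (⟪r, a⟫ * ⟪r, b⟫) * ⟪a, b⟫) ≤ 2 * (|⟪r, a⟫| * |⟪r, b⟫|) * (‖a‖ * ‖b‖) := by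
    have h2 : |⟪r, a⟫ * ⟪r, b⟫ * ⟪a, b⟫| ≤ |⟪r, a⟫| * |⟪r, b⟫| * (‖a‖ * ‖b‖) := by
      rw [abs_mul, abs_mul]; exact mul_le_mul_of_nonneg_left hcs (by positivity)
    linarith [neg_abs_le (⟪r, a⟫ * ⟪r, b⟫ * ⟪a, b⟫)]
  have hsq : (|⟪r, a⟫| * ‖b‖ + |⟪r, b⟫| * ‖a‖) ^ 2 =
      ⟪r, a⟫ ^ 2 * ‖b‖ ^ 2 + ⟪r, b⟫ ^ 2 * ‖a‖ ^ 2 + 2 * (|⟪r, a⟫| * |⟪r, b⟫|) * (‖a‖ * ‖b‖) := by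
    rw [add_sq, mul_pow, mul_pow, sq_abs, sq_abs]; ring
  rw [hkey, hsq]; linarith

/-! ## §3 Tilt of a nearly-orthogonal unit vector -/

/-- ★ TILT BOUND.  `ν` a unit normal of the plane of `a, b`; `n'` a unit vector with `|⟪n',a⟫| ≤ ε` and
`|⟪n',b⟫| ≤ ε`.  Then `(1 − ⟪ν,n'⟫²) (‖a‖²‖b‖² − ⟪a,b⟫²) ≤ (ε (‖a‖ + ‖b‖))²`; i.e. `n'` is within
angle `≈ ε (‖a‖+‖b‖)/√G` of `±ν`. -/
theorem tilt_bound {ν a b n' : E3} {ε : ℝ} (hν : ‖ν‖ = 1) (ha : ⟪ν, a⟫ = 0) (hb : ⟪ν, b⟫ = 0) (hn' : ‖n'‖ = 1)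
    (hea : |⟪n', a⟫| ≤ ε) (heb : |⟪n', b⟫| ≤ ε) :
    (1 - ⟪ν, n'⟫ ^ 2) * (‖a‖ ^ 2 * ‖b‖ ^ 2 - ⟪a, b⟫ ^ 2) ≤ (ε * (‖a‖ + ‖b‖)) ^ 2 := by
  have hνν : ⟪ν, ν⟫ = 1 := by rw [real_inner_self_eq_norm_sq, hν, one_pow]
  have hc : ⟪n', ν⟫ = ⟪ν, n'⟫ := real_inner_comm _ _
  have hr : ⟪ν, n' - ⟪ν, n'⟫ • ν⟫ = 0 := by rw [inner_sub_right, inner_smul_right, hνν, mul_one, sub_self]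
  have hra : ⟪n' - ⟪ν, n'⟫ • ν, a⟫ = ⟪n', a⟫ := by rw [inner_sub_left, inner_smul_left, ha]; simp
  have hrb : ⟪n' - ⟪ν, n'⟫ • ν, b⟫ = ⟪n', b⟫ := by rw [inner_sub_left, inner_smul_left, hb]; simp
  have hrr : ‖n' - ⟪ν, n'⟫ • ν‖ ^ 2 = 1 - ⟪ν, n'⟫ ^ 2 := by
    rw [norm_sub_sq_real, inner_smul_right, hc, norm_smul, hn', hν, Real.norm_eq_abs, mul_one, sq_abs]; ring
  have hp := planar_pinning hν ha hb hr
  rw [hrr, hra, hrb] at hp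
  have hε : 0 ≤ ε := le_trans (abs_nonneg _) hea
  calc (1 - ⟪ν, n'⟫ ^ 2) * (‖a‖ ^ 2 * ‖b‖ ^ 2 - ⟪a, b⟫ ^ 2) ≤ (|⟪n', a⟫| * ‖b‖ + |⟪n', b⟫| * ‖a‖) ^ 2 := hp
    _ ≤ (ε * (‖a‖ + ‖b‖)) ^ 2 := by
        have h1 : |⟪n', a⟫| * ‖b‖ + |⟪n', b⟫| * ‖a‖ ≤ ε * (‖a‖ + ‖b‖) := by
          nlinarith [mul_le_mul_of_nonneg_right hea (norm_nonneg b), mul_le_mul_of_nonneg_right heb (norm_nonneg a)]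
        exact pow_le_pow_left₀ (by positivity) h1 2

/-! ## §4 Height transfer between two nearby normals -/

/-- ★ HEIGHT TRANSFER.  For unit vectors `ν, n'` and any `z`:
`(⟪ν,z⟫ − ⟪n',z⟫⟪ν,n'⟫)² ≤ (1 − ⟪ν,n'⟫²) (‖z‖² − ⟪n',z⟫²)` — the `ν`-height of `z` is its `n'`-height times
`cos ∠(ν,n')`, up to `sin ∠(ν,n')` times the component of `z` orthogonal to `n'` (Cauchy–Schwarz in `n'^⊥`). -/
theorem height_transfer {ν n' : E3} (hν : ‖ν‖ = 1) (hn' : ‖n'‖ = 1) (z : E3) :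
    (⟪ν, z⟫ - ⟪n', z⟫ * ⟪ν, n'⟫) ^ 2 ≤ (1 - ⟪ν, n'⟫ ^ 2) * (‖z‖ ^ 2 - ⟪n', z⟫ ^ 2) := by
  have hnn : ⟪n', n'⟫ = 1 := by rw [real_inner_self_eq_norm_sq, hn', one_pow]
  have h1 : ⟪ν, z⟫ - ⟪n', z⟫ * ⟪ν, n'⟫ = ⟪ν - ⟪ν, n'⟫ • n', z - ⟪n', z⟫ • n'⟫ := by
    rw [inner_sub_left, inner_sub_right, inner_sub_right, inner_smul_right, inner_smul_left, inner_smul_left,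
      inner_smul_right, hnn, real_inner_comm n' ν]; ring
  have hmm : ‖ν - ⟪ν, n'⟫ • n'‖ ^ 2 = 1 - ⟪ν, n'⟫ ^ 2 := by
    rw [norm_sub_sq_real, inner_smul_right, norm_smul, hn', hν, Real.norm_eq_abs, mul_one, sq_abs]; ring
  have hss : ‖z - ⟪n', z⟫ • n'‖ ^ 2 = ‖z‖ ^ 2 - ⟪n', z⟫ ^ 2 := by
    rw [norm_sub_sq_real, inner_smul_right, norm_smul, hn', Real.norm_eq_abs, mul_one, sq_abs, real_inner_comm z n']; ring
  rw [h1, ← hmm, ← hss, ← sq_abs, ← mul_pow]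
  exact pow_le_pow_left₀ (abs_nonneg _) (abs_real_inner_le_norm _ _) 2

/-! ## §5 Lattice reduction in the period plane -/

/-- a planar vector is a real combination of two independent planar vectors (Cramer). -/
theorem exists_planar_coords {ν a b t : E3} (hν : ‖ν‖ = 1) (ha : ⟪ν, a⟫ = 0) (hb : ⟪ν, b⟫ = 0) (ht : ⟪ν, t⟫ = 0)
    (hG : 0 < ‖a‖ ^ 2 * ‖b‖ ^ 2 - ⟪a, b⟫ ^ 2) : ∃ α β : ℝ, t = α • a + β • b := by
  obtain ⟨e, he⟩ := exists_onb hν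
  rw [← he] at ha hb ht
  have hD : (⟪e 1, a⟫ * ⟪e 2, b⟫ - ⟪e 2, a⟫ * ⟪e 1, b⟫) ^ 2 = ‖a‖ ^ 2 * ‖b‖ ^ 2 - ⟪a, b⟫ ^ 2 := det_sq_eq_gram e ha hb
  have hd : ⟪e 1, a⟫ * ⟪e 2, b⟫ - ⟪e 2, a⟫ * ⟪e 1, b⟫ ≠ 0 := by intro h; rw [h] at hD; nlinarith
  refine ⟨(⟪e 1, t⟫ * ⟪e 2, b⟫ - ⟪e 2, t⟫ * ⟪e 1, b⟫) / (⟪e 1, a⟫ * ⟪e 2, b⟫ - ⟪e 2, a⟫ * ⟪e 1, b⟫),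
    (⟪e 1, a⟫ * ⟪e 2, t⟫ - ⟪e 2, a⟫ * ⟪e 1, t⟫) / (⟪e 1, a⟫ * ⟪e 2, b⟫ - ⟪e 2, a⟫ * ⟪e 1, b⟫), ?_⟩
  rw [← sub_eq_zero]
  apply eq_zero_of_frame e
  · rw [inner_sub_right, inner_add_right, inner_smul_right, inner_smul_right, ht, ha, hb]; ring
  · rw [inner_sub_right, inner_add_right, inner_smul_right, inner_smul_right, div_mul_eq_mul_div, div_mul_eq_mul_div,
      ← add_div, sub_eq_zero, eq_div_iff hd]; ring
  · rw [inner_sub_right, inner_add_right, inner_smul_right, inner_smul_right, div_mul_eq_mul_div, div_mul_eq_mul_div,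
      ← add_div, sub_eq_zero, eq_div_iff hd]; ring

/-- ★ LATTICE REDUCTION (crude covering radius).  For a unit normal `ν`, independent planar periods `a, b`
and a planar vector `t` there are integers `i, j` with `‖t − (i • a + j • b)‖ ≤ (‖a‖ + ‖b‖) / 2`. -/
theorem exists_lattice_reduction {ν a b t : E3} (hν : ‖ν‖ = 1) (ha : ⟪ν, a⟫ = 0) (hb : ⟪ν, b⟫ = 0) (ht : ⟪ν, t⟫ = 0)
    (hG : 0 < ‖a‖ ^ 2 * ‖b‖ ^ 2 - ⟪a, b⟫ ^ 2) :
    ∃ i j : ℤ, ‖t - ((i : ℝ) • a + (j : ℝ) • b)‖ ≤ (‖a‖ + ‖b‖) / 2 := by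
  obtain ⟨α, β, rfl⟩ := exists_planar_coords hν ha hb ht hG
  refine ⟨round α, round β, ?_⟩
  have h : α • a + β • b - (((round α : ℤ) : ℝ) • a + ((round β : ℤ) : ℝ) • b) =
      (α - round α) • a + (β - round β) • b := by
    rw [sub_smul, sub_smul]; abel
  rw [h]
  calc ‖(α - round α) • a + (β - round β) • b‖ ≤ ‖(α - round α) • a‖ + ‖(β - round β) • b‖ := norm_add_le _ _
    _ = |α - round α| * ‖a‖ + |β - round β| * ‖b‖ := by rw [norm_smul, norm_smul, Real.norm_eq_abs, Real.norm_eq_abs]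
    _ ≤ 1 / 2 * ‖a‖ + 1 / 2 * ‖b‖ := by
        gcongr
        · exact abs_sub_round α
        · exact abs_sub_round β
    _ = (‖a‖ + ‖b‖) / 2 := by ring

/-! ## §6 Pythagoras along the normal -/

/-- `‖t + h • ν‖² = ‖t‖² + h²` for `t ⊥ ν`, `ν` a unit vector. -/
theorem norm_sq_add_smul_normal {ν t : E3} (hν : ‖ν‖ = 1) (ht : ⟪ν, t⟫ = 0) (h : ℝ) :
    ‖t + h • ν‖ ^ 2 = ‖t‖ ^ 2 + h ^ 2 := by
  have ht' : ⟪t, ν⟫ = 0 := by rw [real_inner_comm]; exact ht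
  rw [norm_add_sq_real, inner_smul_right, ht', norm_smul, hν, Real.norm_eq_abs, mul_one, sq_abs]; ring

/-- the normal and planar parts of a vector: `z = (z − ⟪ν,z⟫ ν) + ⟪ν,z⟫ ν` with the first summand `⊥ ν`, and
`‖z‖² = ‖z − ⟪ν,z⟫ ν‖² + ⟪ν,z⟫²`. -/
theorem norm_sq_eq_planar_add_height {ν : E3} (hν : ‖ν‖ = 1) (z : E3) :
    ⟪ν, z - ⟪ν, z⟫ • ν⟫ = 0 ∧ ‖z‖ ^ 2 = ‖z - ⟪ν, z⟫ • ν‖ ^ 2 + ⟪ν, z⟫ ^ 2 := by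
  have hνν : ⟪ν, ν⟫ = 1 := by rw [real_inner_self_eq_norm_sq, hν, one_pow]
  have h0 : ⟪ν, z - ⟪ν, z⟫ • ν⟫ = 0 := by rw [inner_sub_right, inner_smul_right, hνν, mul_one, sub_self]
  refine ⟨h0, ?_⟩
  have := norm_sq_add_smul_normal hν h0 ⟪ν, z⟫
  rw [sub_add_cancel] at this
  exact this

end Summit.AtomisticToContinuum.Crystallization.Theorems.ChartedPlanarOrderLayerFrame
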